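import Literature.NumberTheory.DiophantineGeometry.ShuteFourSquarefulCounting
import Literature.NumberTheory.Sieve.DivisorBound

/-!
# Shute (2021), §3: the elementary fourth-moment bound `N(X, Y) ≪_ε X^{2+ε} Y^{3+ε}`

Third companion to `ShuteFourSquareful.lean` (named fact `Shute2021_prop32` = Shute's Prop. 3.2),
after `ShuteFourSquarefulHolder.lean` (Hölder: `N(𝐗, 𝐘)⁴ ≤ ∏ᵢ N(Xᵢ, Yᵢ)`;
`Shute2021_prop32 ↔ (N(X, Y) ≪_ε X^{2+ε} Y^{8/3+ε})`) and `ShuteFourSquarefulCounting.lean`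
(`N(X, Y) ≤ (2Y+1) K(X, Y)`, `K = Σ_t G(t)`, and the divisor-type bounds for the slices `G(t)`).

Here `N(X, Y)` is the fourth moment `Shute2021.fourthMoment X Y = #{x₁²y₁³ + x₂²y₂³ =
x₃²y₃³ + x₄²y₄³ : 0 < |xᵢ| ≤ X, 0 < |yᵢ| ≤ Y, yᵢ square-free}`. We PROVE, unconditionally,

* `Shute2021.fourthMoment_le_three`: `∀ ε > 0, ∃ C > 0, ∀ X Y ≥ 1, N(X, Y) ≤ C X^{2+ε} Y^{3+ε}`;
* `Shute2021.quadricCount_le_threeQuarters`: `N(𝐗, 𝐘) ≤ C_ε (∏Xᵢ)^{1/2+ε} (∏Yᵢ)^{3/4+ε}`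
  (the shape of Prop. 3.2 with `3/4` in place of the printed `2/3`);
* `Shute2021.addEnergy_squarefulShape_le_three`, `Shute2021.addEnergy_le_three_of_subset`:
  `E[S, S] ≤ C_ε (XY)^ε X² Y³` for the squareful shape `S(X, Y) = {x²y³}` and its subsets
  (unconditional counterparts of `Shute2021_prop32.addEnergy_squarefulShape_le` /
  `Shute2021_prop32.addEnergy_le_of_subset`, which give `Y^{8/3}` conditionally on Prop. 3.2).

## The assembly

With `δ = ε/6`, the divisor bound `τ(n) ≤ C_δ n^δ`
(`Literature.NumberTheory.Sieve.exists_card_divisors_le_mul_rpow`, Hardy–Wright Thm 315),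
`|val p| ≤ X²Y³`, `|m| ≤ B = 2X²Y³`, `T = C_δ B^δ ≥ 1`, `#P ≤ 9XY`:
`G(t) ≤ 2#P·[t diagonal] + 4T²`, `#{t diagonal} ≤ 4 #P T`, so `K ≤ 12 #P² T²` and
`N(X, Y) ≤ (2Y+1) · 12 #P² T² ≤ 2916 C_δ² · X²Y³ (2X²Y³)^{ε/3} ≤ 2916 C_δ² 2^{ε/3} X^{2+ε} Y^{3+ε}`.

## Relation to the source

A. Shute, *Sums of four squareful numbers*, arXiv:2104.06966, §3, asserts the stronger
`N(X, Y) = O(X^{2+ε} Y^{8/3+ε})` ("(the old prop)") via `N(X, Y) ≤ XY · L'(X, Y)` (Cauchy–Schwarz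
in `x` and in `y`) followed by `L' ≪ X^{1+ε} Y^{5/3+ε}`. A Cauchy–Schwarz over a full variable
costs its full range on the diagonal solutions (`≍ X²Y²` of them), which is why a single
Cauchy–Schwarz, in `y₁`, is used here and why the exponent obtained is `3`; the exponent `8/3`
(equivalently Prop. 3.2, by `Shute2021_prop32_iff_fourthMoment_le`) is not proved in this library.

## References

* A. Shute, *Sums of four squareful numbers*, arXiv:2104.06966 (2021), §3 (proof of Prop. 3.2:
  the fourth moment `N(X, Y)`, counting by the divisor bound). [Shute2021]
* G. H. Hardy, E. M. Wright, *An Introduction to the Theory of Numbers*, 6th ed. (OUP 2008),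
  Thm 315 (the divisor bound), vendored in `Literature/NumberTheory/Sieve/DivisorBound.lean`.
  [HardyWright2008]
-/

noncomputable section

open Finset

namespace Literature.NumberTheory.DiophantineGeometry

namespace Shute2021

/-! ### Assembly: `N(X, Y) ≤ C_ε X^{2+ε} Y^{3+ε}` -/

section RealBound

/-- Sizes of the coordinate ranges: `#xdom X ≤ 2X + 1`. [folklore] -/
theorem card_xdom_le (X : ℕ) : #(xdom X) ≤ 2 * X + 1 := by
  unfold xdom
  refine (card_filter_le _ _).trans (le_of_eq ?_)
  rw [Int.card_Icc, show (X : ℤ) + 1 - -(X : ℤ) = ((2 * X + 1 : ℕ) : ℤ) by push_cast; ring,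
    Int.toNat_natCast]

/-- Sizes of the coordinate ranges: `#ydom Y ≤ 2Y + 1`. [folklore] -/
theorem card_ydom_le (Y : ℕ) : #(ydom Y) ≤ 2 * Y + 1 := by
  unfold ydom
  refine (card_filter_le _ _).trans (le_of_eq ?_)
  rw [Int.card_Icc, show (Y : ℤ) + 1 - -(Y : ℤ) = ((2 * Y + 1 : ℕ) : ℤ) by push_cast; ring,
    Int.toNat_natCast]

/-- `#pts X Y ≤ 9 X Y` for `X, Y ≥ 1`. [folklore] -/
theorem card_pts_le {X Y : ℕ} (hX : 1 ≤ X) (hY : 1 ≤ Y) : (#(pts X Y) : ℝ) ≤ 9 * X * Y := by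
  have h : #(pts X Y) ≤ (2 * X + 1) * (2 * Y + 1) := by
    rw [pts_eq, card_product]
    exact Nat.mul_le_mul (card_xdom_le X) (card_ydom_le Y)
  have h' : (#(pts X Y) : ℝ) ≤ (2 * X + 1) * (2 * Y + 1) := by exact_mod_cast h
  have hX1 : (1 : ℝ) ≤ X := by exact_mod_cast hX
  have hY1 : (1 : ℝ) ≤ Y := by exact_mod_cast hY
  nlinarith

/-- The divisor bound transported to `τ(|m|)` for integers `|m| ≤ B`. [folklore] -/
theorem tau_le_of_abs_le {Cd δ B : ℝ} (hδ : 0 ≤ δ) (hC0 : 0 ≤ Cd)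
    (hCd : ∀ n : ℕ, n ≠ 0 → ((Nat.divisors n).card : ℝ) ≤ Cd * (n : ℝ) ^ δ)
    {m : ℤ} (hm : m ≠ 0) (hB : |(m : ℝ)| ≤ B) : (tau m : ℝ) ≤ Cd * B ^ δ := by
  have h1 := hCd m.natAbs (Int.natAbs_ne_zero.2 hm)
  have h2 : ((m.natAbs : ℕ) : ℝ) = |(m : ℝ)| := by rw [Nat.cast_natAbs, Int.cast_abs]
  calc (tau m : ℝ) = ((Nat.divisors m.natAbs).card : ℝ) := rfl
    _ ≤ Cd * ((m.natAbs : ℕ) : ℝ) ^ δ := h1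
    _ ≤ Cd * B ^ δ := by
        rw [h2]
        exact mul_le_mul_of_nonneg_left (Real.rpow_le_rpow (abs_nonneg _) hB hδ) hC0

/-- Exponent bookkeeping for the final step: for `X, Y ≥ 1` and `ε > 0`,
`X² Y³ (2X²Y³)^{ε/3} ≤ 2^{ε/3} X^{2+ε} Y^{3+ε}`. [folklore] -/
theorem sq_cube_mul_rpow_le {X Y ε : ℝ} (hX : 1 ≤ X) (hY : 1 ≤ Y) (hε : 0 < ε) :
    X ^ 2 * Y ^ 3 * (2 * X ^ 2 * Y ^ 3) ^ (ε / 3) ≤ 2 ^ (ε / 3) * X ^ (2 + ε) * Y ^ (3 + ε) := by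
  have hX0 : 0 < X := by linarith
  have hY0 : 0 < Y := by linarith
  have e1 : (2 * X ^ 2 * Y ^ 3) ^ (ε / 3) = 2 ^ (ε / 3) * (X ^ 2) ^ (ε / 3) * (Y ^ 3) ^ (ε / 3) := by
    rw [Real.mul_rpow (by positivity) (by positivity), Real.mul_rpow (by positivity) (by positivity)]
  have e2 : (X ^ 2) ^ (ε / 3) ≤ X ^ ε := by
    rw [← Real.rpow_two, ← Real.rpow_mul hX0.le]
    exact Real.rpow_le_rpow_of_exponent_le hX (by linarith)
  have e3 : (Y ^ 3) ^ (ε / 3) = Y ^ ε := by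
    rw [show Y ^ 3 = Y ^ ((3 : ℕ) : ℝ) from (Real.rpow_natCast Y 3).symm, ← Real.rpow_mul hY0.le]
    congr 1
    push_cast
    ring
  have e4 : X ^ (2 + ε) = X ^ 2 * X ^ ε := by
    rw [Real.rpow_add hX0, Real.rpow_two]
  have e5 : Y ^ (3 + ε) = Y ^ 3 * Y ^ ε := by
    rw [Real.rpow_add hY0, show ((3 : ℝ)) = ((3 : ℕ) : ℝ) by norm_num, Real.rpow_natCast]
  rw [e1, e3, e4, e5]
  have : 0 ≤ 2 ^ (ε / 3) * Y ^ 3 * Y ^ ε * X ^ 2 := by positivity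
  calc X ^ 2 * Y ^ 3 * (2 ^ (ε / 3) * (X ^ 2) ^ (ε / 3) * Y ^ ε)
      = (2 ^ (ε / 3) * Y ^ 3 * Y ^ ε * X ^ 2) * (X ^ 2) ^ (ε / 3) := by ring
    _ ≤ (2 ^ (ε / 3) * Y ^ 3 * Y ^ ε * X ^ 2) * X ^ ε := mul_le_mul_of_nonneg_left e2 this
    _ = 2 ^ (ε / 3) * (X ^ 2 * X ^ ε) * (Y ^ 3 * Y ^ ε) := by ring

/-- **The elementary fourth-moment bound** (one Cauchy–Schwarz in `y₁`, then the divisor bound):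
for every `ε > 0` there is `C = C(ε) > 0` with `N(X, Y) ≤ C X^{2+ε} Y^{3+ε}` for all `X, Y ≥ 1`,
where `N(X, Y)` is Shute's fourth moment (`Shute2021.fourthMoment`). The paper asserts the
exponent `8/3 + ε` in place of `3 + ε` ("(the old prop)", §3), by an argument whose
Cauchy–Schwarz step does not give it; `3 + ε` is what the method yields. [folklore] -/
theorem fourthMoment_le_three :
    ∀ ε : ℝ, 0 < ε → ∃ C : ℝ, 0 < C ∧ ∀ X Y : ℕ, 1 ≤ X → 1 ≤ Y →
      (fourthMoment X Y : ℝ) ≤ C * (X : ℝ) ^ (2 + ε) * (Y : ℝ) ^ (3 + ε) := by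
  intro ε hε
  obtain ⟨Cd, hCd1, hCd⟩ :=
    Literature.NumberTheory.Sieve.exists_card_divisors_le_mul_rpow (ε := ε / 6) (by positivity)
  refine ⟨2916 * Cd ^ 2 * (2 : ℝ) ^ (ε / 3), by positivity, fun X Y hX hY => ?_⟩
  have hX1 : (1 : ℝ) ≤ X := by exact_mod_cast hX
  have hY1 : (1 : ℝ) ≤ Y := by exact_mod_cast hY
  set P := pts X Y with hP_def
  set B : ℝ := 2 * (X : ℝ) ^ 2 * (Y : ℝ) ^ 3 with hB_def
  have hXY1 : (1 : ℝ) ≤ (X : ℝ) ^ 2 * (Y : ℝ) ^ 3 := one_le_mul_of_one_le_of_one_le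
    (one_le_pow₀ hX1) (one_le_pow₀ hY1)
  have hB1 : (1 : ℝ) ≤ B := by rw [hB_def]; nlinarith
  set TB : ℝ := Cd * B ^ (ε / 6) with hTB_def
  have hTB1 : 1 ≤ TB :=
    one_le_mul_of_one_le_of_one_le hCd1 (Real.one_le_rpow hB1 (by positivity))
  -- uniform divisor bounds
  have htau : ∀ m : ℤ, m ≠ 0 → |(m : ℝ)| ≤ B → (tau m : ℝ) ≤ TB := fun m hm hmB =>
    tau_le_of_abs_le (by positivity) (by linarith) hCd hm hmB
  have hvalB : ∀ p ∈ P, |((val p : ℤ) : ℝ)| ≤ (X : ℝ) ^ 2 * (Y : ℝ) ^ 3 := fun p hp => by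
    have h := abs_val_le hp
    have h' : ((|val p| : ℤ) : ℝ) ≤ (((X : ℤ) ^ 2 * (Y : ℤ) ^ 3 : ℤ) : ℝ) := by exact_mod_cast h
    push_cast at h'
    exact h'
  have hmB : ∀ t ∈ P ×ˢ P, |((val t.1 - val t.2 : ℤ) : ℝ)| ≤ B := fun t ht => by
    obtain ⟨h1, h2⟩ := mem_product.1 ht
    push_cast
    calc |((val t.1 : ℤ) : ℝ) - val t.2| ≤ |((val t.1 : ℤ) : ℝ)| + |((val t.2 : ℤ) : ℝ)| :=
          abs_sub _ _
      _ ≤ (X : ℝ) ^ 2 * (Y : ℝ) ^ 3 + (X : ℝ) ^ 2 * (Y : ℝ) ^ 3 :=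
          add_le_add (hvalB _ h1) (hvalB _ h2)
      _ = B := by rw [hB_def]; ring
  -- the slices
  have hslice : ∀ t ∈ P ×ˢ P, (sliceCount X Y t : ℝ) ≤
      2 * #P * (if val t.1 = val t.2 then 1 else 0) + 4 * TB ^ 2 := by
    intro t ht
    split_ifs with h
    · have h1 : (sliceCount X Y t : ℝ) ≤ 2 * #P := by exact_mod_cast sliceCount_le_of_eq h
      nlinarith
    · have h1 : (sliceCount X Y t : ℝ) ≤ 2 * tau (val t.1 - val t.2) * (2 * tau (val t.1 - val t.2)) := by
        exact_mod_cast sliceCount_le_of_ne h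
      have h2 := htau _ (sub_ne_zero.2 h) (hmB t ht)
      have h3 : (0 : ℝ) ≤ tau (val t.1 - val t.2) := Nat.cast_nonneg _
      nlinarith
  have hsum : (monoCount X Y : ℝ) ≤
      2 * #P * #{t ∈ P ×ˢ P | val t.1 = val t.2} + #(P ×ˢ P) * (4 * TB ^ 2) := by
    rw [monoCount_eq_sum, Nat.cast_sum]
    calc _ ≤ ∑ t ∈ P ×ˢ P, (2 * #P * (if val t.1 = val t.2 then 1 else 0) + 4 * TB ^ 2) :=
          sum_le_sum hslice
      _ = _ := by
          rw [sum_add_distrib, ← mul_sum, sum_boole, sum_const, nsmul_eq_mul]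
  have hdiag : (#{t ∈ P ×ˢ P | val t.1 = val t.2} : ℝ) ≤ #P * (4 * TB) := by
    calc _ ≤ ((∑ p' ∈ P, 4 * tau (val p') : ℕ) : ℝ) := by
          exact_mod_cast card_filter_val_eq_val_le X Y
      _ = ∑ p' ∈ P, 4 * (tau (val p') : ℝ) := by push_cast; rfl
      _ ≤ ∑ p' ∈ P, 4 * TB := sum_le_sum fun p' hp' => by
          have := htau (val p') (val_ne_zero hp')
            ((hvalB p' hp').trans (by rw [hB_def]; nlinarith))
          linarith
      _ = #P * (4 * TB) := by rw [sum_const, nsmul_eq_mul]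
  have hPP : (#(P ×ˢ P) : ℝ) = #P * #P := by rw [card_product]; push_cast; ring
  have hP0 : (0 : ℝ) ≤ #P := Nat.cast_nonneg _
  have hmono : (monoCount X Y : ℝ) ≤ 12 * (#P : ℝ) ^ 2 * TB ^ 2 := by
    have hTB2 : TB ≤ TB ^ 2 := by nlinarith
    calc (monoCount X Y : ℝ) ≤ 2 * #P * (#P * (4 * TB)) + #P * #P * (4 * TB ^ 2) := by
          rw [← hPP]
          exact hsum.trans (by nlinarith [hdiag, hP0])
      _ = 8 * (#P : ℝ) ^ 2 * TB + 4 * (#P : ℝ) ^ 2 * TB ^ 2 := by ring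
      _ ≤ 8 * (#P : ℝ) ^ 2 * TB ^ 2 + 4 * (#P : ℝ) ^ 2 * TB ^ 2 := by nlinarith [sq_nonneg (#P : ℝ)]
      _ = 12 * (#P : ℝ) ^ 2 * TB ^ 2 := by ring
  have hE : (fourthMoment X Y : ℝ) ≤ (2 * Y + 1) * monoCount X Y := by
    rw [fourthMoment_eq_diffEnergy]
    exact_mod_cast diffEnergy_le_mul_monoCount X Y
  have hPle : (#P : ℝ) ≤ 9 * X * Y := card_pts_le hX hY
  have hTB2 : TB ^ 2 = Cd ^ 2 * B ^ (ε / 3) := by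
    rw [hTB_def, mul_pow, ← Real.rpow_two (B ^ (ε / 6)), ← Real.rpow_mul (by linarith)]
    congr 2
    ring
  have hfin := sq_cube_mul_rpow_le hX1 hY1 hε
  calc (fourthMoment X Y : ℝ) ≤ (2 * Y + 1) * (12 * (#P : ℝ) ^ 2 * TB ^ 2) :=
        hE.trans (mul_le_mul_of_nonneg_left hmono (by positivity))
    _ ≤ (3 * Y) * (12 * (9 * X * Y) ^ 2 * TB ^ 2) := by gcongr; linarith
    _ = 2916 * Cd ^ 2 * ((X : ℝ) ^ 2 * (Y : ℝ) ^ 3 * (2 * (X : ℝ) ^ 2 * (Y : ℝ) ^ 3) ^ (ε / 3)) := by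
        rw [hTB2, hB_def]; ring
    _ ≤ 2916 * Cd ^ 2 * ((2 : ℝ) ^ (ε / 3) * (X : ℝ) ^ (2 + ε) * (Y : ℝ) ^ (3 + ε)) :=
        mul_le_mul_of_nonneg_left hfin (by positivity)
    _ = 2916 * Cd ^ 2 * (2 : ℝ) ^ (ε / 3) * (X : ℝ) ^ (2 + ε) * (Y : ℝ) ^ (3 + ε) := by ring

end RealBound

/-! ### Consequences: the box count and the additive energy of the squareful shape -/

section Consequences

/-- **`N(𝐗, 𝐘) ≪_ε (X₁X₂X₃X₄)^{1/2+ε} (Y₁Y₂Y₃Y₄)^{3/4+ε}`** — the proved form of Shute's Prop. 3.2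
with exponent `3/4` in place of the printed `2/3` (Hölder + `fourthMoment_le_three`).
[folklore] -/
theorem quadricCount_le_threeQuarters :
    ∀ ε : ℝ, 0 < ε → ∃ C : ℝ, 0 < C ∧ ∀ X Y : Fin 4 → ℕ, (∀ i, 1 ≤ X i) → (∀ i, 1 ≤ Y i) →
      (quadricCount X Y : ℝ) ≤
        C * (∏ i, (X i : ℝ)) ^ (1 / 2 + ε) * (∏ i, (Y i : ℝ)) ^ (3 / 4 + ε) := by
  intro ε hε
  obtain ⟨C, hC, H⟩ := quadricCount_le_of_fourthMoment_le (θ := 3) fourthMoment_le_three ε hε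
  refine ⟨C, hC, fun X Y hX hY => ?_⟩
  have := H X Y hX hY
  norm_num at this
  exact this

/-- **Additive energy of the squareful shape, proved form**: for
`S = S(X, Y) = {x²y³ : 1 ≤ x ≤ X, 1 ≤ y ≤ Y, y square-free}` (`Shute2021.squarefulShape`, spelled
as in route item `SquarefulShapeEnergy`), `E[S, S] ≤ C_ε (XY)^ε X² Y³` for all `X, Y ≥ 1`
(compare `Shute2021_prop32.addEnergy_squarefulShape_le`: `Y^{8/3}` conditionally on Prop. 3.2).
[folklore] -/
theorem addEnergy_squarefulShape_le_three :
    ∀ ε : ℝ, 0 < ε → ∃ C : ℝ, 0 < C ∧ ∀ X Y : ℕ, 1 ≤ X → 1 ≤ Y →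
      (Finset.addEnergy (squarefulShape X Y) (squarefulShape X Y) : ℝ) ≤
        C * ((X : ℝ) * Y) ^ ε * (X : ℝ) ^ 2 * (Y : ℝ) ^ 3 := by
  intro ε hε
  obtain ⟨C, hC, hN⟩ := fourthMoment_le_three ε hε
  refine ⟨C, hC, fun X Y hX hY => ?_⟩
  have hX0 : (0 : ℝ) < X := by exact_mod_cast hX
  have hY0 : (0 : ℝ) < Y := by exact_mod_cast hY
  calc (Finset.addEnergy (squarefulShape X Y) (squarefulShape X Y) : ℝ)
      ≤ fourthMoment X Y := by exact_mod_cast addEnergy_squarefulShape_le_fourthMoment X Y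
    _ ≤ C * (X : ℝ) ^ (2 + ε) * (Y : ℝ) ^ (3 + ε) := hN X Y hX hY
    _ = C * ((X : ℝ) * Y) ^ ε * (X : ℝ) ^ 2 * (Y : ℝ) ^ 3 := by
        rw [Real.rpow_add hX0, Real.rpow_add hY0, Real.mul_rpow hX0.le hY0.le, Real.rpow_two,
          show ((3 : ℝ)) = ((3 : ℕ) : ℝ) by norm_num, Real.rpow_natCast]
        ring

/-- Monotone form for sub-shapes (dyadic pieces `y ~ R` with `Y = 2R`): for every
`T ⊆ S(X, Y)`, `E[T, T] ≤ C_ε (XY)^ε X² Y³`. [folklore] -/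
theorem addEnergy_le_three_of_subset :
    ∀ ε : ℝ, 0 < ε → ∃ C : ℝ, 0 < C ∧ ∀ X Y : ℕ, 1 ≤ X → 1 ≤ Y → ∀ T : Finset ℕ,
      T ⊆ squarefulShape X Y →
        (Finset.addEnergy T T : ℝ) ≤ C * ((X : ℝ) * Y) ^ ε * (X : ℝ) ^ 2 * (Y : ℝ) ^ 3 := by
  intro ε hε
  obtain ⟨C, hC, hE⟩ := addEnergy_squarefulShape_le_three ε hε
  refine ⟨C, hC, fun X Y hX hY T hT => le_trans ?_ (hE X Y hX hY)⟩
  exact_mod_cast Finset.addEnergy_mono hT hT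

end Consequences

end Shute2021

end Literature.NumberTheory.DiophantineGeometry
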